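import Mathlib
import Literature.Computability.AlgebraicComplexity.StandardFamiliesProofs
import Summits.ValiantsHypothesis.ValiantsHypothesis.Theses.GeneratorObstructions
import Summits.ValiantsHypothesis.ValiantsHypothesis.Theorems.GeneratorObstructionsGenInheritanceUpper

/-!
# `GeneratorObstructions.GenInheritance` holds (stmt-ValiantsHypothesis-11659)

The route's support statement `GenInheritance` (inheritance for generator types, card P1c): for
`1 ≤ m` and every `e`, if `χ` is a generator type of the algebra of highest-weight vectors of
`ℂ[Δ_m[per_m]]` (`per_m` in its own `m²` lexicographically ordered matrix variables,
`rename toLex (perPoly (Fin m) ℂ)`), i.e. `γ_χ(per_m) ≠ 0`, then some weight `χ'` of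
`GL_{(m+e)²}` of the same size has `γ_{χ'} ≠ 0` for `per_m` placed on the top-left block of the
`(m+e) × (m+e)` matrix variables (`Fin.castAdd e` placement). It is the specialisation of the
general inheritance theorem `GenInheritance.exists_size_eq_and_finrank_ne_zero_rename`
(helper file `GeneratorObstructionsGenInheritanceUpper.lean`) to the injective placement
`(i, j) ↦ (Fin.castAdd e i, Fin.castAdd e j)`; `χ'` is `χ` extended by zero along the final
segment of the lexicographic order (conjugate to the block placement by a permutation matrix).
BLMW 2011 §5.4 / Landsberg 2017 §8.4.1. [folklore]
-/

namespace Summit.ValiantsHypothesis.ValiantsHypothesis.Theorems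

open MvPolynomial
open Literature.NumberTheory.DiophantineGeometry Literature.Computability.AlgebraicComplexity

-- `Summit.ValiantsHypothesis.ValiantsHypothesis.…` is the tree's mandated single-conjunct layout (Sub = Summit).
set_option linter.dupNamespace false

/-- **`GenInheritance` holds** (item stmt-ValiantsHypothesis-11659 of route GeneratorObstructions):
for `1 ≤ m` and every `e`, every generator type `χ` of the algebra of highest-weight vectors of
`ℂ[Δ_m[per_m]]` (`per_m` in its own `m²` lexicographically ordered variables) yields a generator
type `χ'` of the same size of `ℂ[Δ_m[per_m^{(m+e)}]]` (`per_m` placed on the top-left block of the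
`(m+e) × (m+e)` matrix variables): the general inheritance theorem
`GenInheritance.exists_size_eq_and_finrank_ne_zero_rename` for the placement
`(i, j) ↦ (Fin.castAdd e i, Fin.castAdd e j)`. BLMW 2011 §5.4 / Landsberg 2017 §8.4.1. [folklore] -/
theorem genInheritance_proof :
    Summit.ValiantsHypothesis.ValiantsHypothesis.Theses.GeneratorObstructions.GenInheritance := by
  unfold Summit.ValiantsHypothesis.ValiantsHypothesis.Theses.GeneratorObstructions.GenInheritance
  intro m e hm χ h
  have hm0 : m ≠ 0 := by omega
  have hf : (rename toLex (perPoly (Fin m) ℂ) : MvPolynomial (MatIdx m) ℂ).IsHomogeneous m := by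
    simpa using (perPoly_isHomogeneous (n := Fin m) (k := ℂ)).rename_isHomogeneous
      (f := (toLex : Fin m × Fin m → MatIdx m))
  have hf0 : (rename toLex (perPoly (Fin m) ℂ) : MvPolynomial (MatIdx m) ℂ) ≠ 0 :=
    (map_ne_zero_iff _ (rename_injective _ toLex.injective)).mpr (perPoly_ne_zero (Fin m) ℂ)
  have hκ : Function.Injective fun x : MatIdx m =>
      (toLex (Fin.castAdd e (ofLex x).1, Fin.castAdd e (ofLex x).2) : MatIdx (m + e)) := by
    intro x y hxy
    have h1 := toLex.injective hxy
    rw [Prod.mk.injEq] at h1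
    exact ofLex.injective (Prod.ext (Fin.castAdd_injective _ _ h1.1) (Fin.castAdd_injective _ _ h1.2))
  have key := GenInheritance.exists_size_eq_and_finrank_ne_zero_rename _ hκ hf hf0 hm0 χ h
  rw [rename_rename] at key
  exact key

end Summit.ValiantsHypothesis.ValiantsHypothesis.Theorems
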